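import Literature.NumberTheory.DiophantineGeometry.StewartYuPadicLogFormsReduction

/-!
# Stewart 2013, Lemma 5 over `ℚ` from Yu's Theorem I **in its printed shape** (proved reduction)

Topic `NumberTheory/DiophantineGeometry`; namespace `Literature.NumberTheory.DiophantineGeometry.Dioph`.

Fifth file of the named fact `Stewart2013_lemma5_rat` (`StewartYuPadicLogForms.lean`), on top of
`StewartYuPadicLogFormsReduction.lean`. Everything here is **proved** and no named fact is
introduced: Yu's theorem enters only as the HYPOTHESIS `H` of the two `…_of_yuTheoremI` theorems
(the pattern of `Stewart2013_lemma5_rat_of_yuBound`). The point of this file is to shrink the prose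
between the published theorem and the tree: the glue `Stewart2013_lemma5_rat_of_yuBound` takes Yu's
bound in the already massaged display form (P) of Stewart's proof
(`max(log B, G₁, (n+1) log p)` with Stewart's `B = max(2, |bᵢ|)`, no side condition on the `bᵢ`),
and its docstring lists the "elementary remarks" by which (P) follows from K. Yu, *p-adic
logarithmic forms and a problem of Erdős*, Acta Math. 211 (2013) 315–382 [Yu2013], Theorem I.
Here those remarks are PROVED, so that the hypothesis becomes Theorem I for `K = ℚ`, `p ≥ 5`,
read off the page (journal pp. 319–321, 324–325):

> **Main Theorem / Theorem I** [Yu2013, p. 321 (1.16)–(1.18); §1.4]. Assume `n ≥ 2` and (1.5)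
> [void for `p > 2`]. Suppose that `α₁, …, αₙ` are multiplicatively independent elements of `K`,
> `b₁, …, bₙ ∈ ℤ` not all zero, `ord_℘ αⱼ = 0` (1.16) and `ord_p bₙ ≤ ord_p bⱼ` for `1 ≤ j ≤ n`
> (1.17). Then `ord_℘(Ξ − 1) < C₁(n, d, ℘, a) h₀(α₁)⋯h₀(αₙ) h⁽¹⁾`, where
> (1.9)  `C₁ = c⁽¹⁾ (a⁽¹⁾)ⁿ · nⁿ(n+1)^{n+1}/n! · d^{n+2} log*d/(q^u f_℘ log p)
>              · max{p^{f_℘}/(δ(a)(f_℘ log p)^{n+1}), eⁿ/nⁿ} · max{log(e⁴(n+1)d), e_℘, f_℘ log p}`,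
> (1.13) `h⁽¹⁾ = max{ log(ω(d) · max_{1≤j<n}(|bₙ|/h₀(αⱼ) + |bⱼ|/h₀(αₙ))), log B, G₁(n,d), (n+1) f_℘ log p }`,
> (1.14) `B = min_{bⱼ ≠ 0} |bⱼ|`, (1.15) `ω(1) = log 2 · log 3/log 6`,
> (1.11) `G₁(n,d) = (n+1)(a₀⁽¹⁾ n + a₁⁽¹⁾ + log(a₀⁽¹⁾ n + a₂⁽¹⁾) + log d)`, and for `p ≥ 5`,
> `e_℘ = 1`, `d = 1` (case (III.2), (1.28), (1.30), (1.31)): `a⁽¹⁾ = 7(p−1)/(p−2)`,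
> `a₀⁽¹⁾ = 2 + log 7`, `c⁽¹⁾ = 1790`, `a₁⁽¹⁾ = a₂⁽¹⁾ = 5.84`.

For `K = ℚ`: `d = 1`, `℘ = p`, `e_℘ = f_℘ = 1`, `q = 2`, `α₀ = ζ₂ = −1` and `q^u = 2` (`ζ₄ ∉ ℚ`),
`log* 1 = 1`, `ord_℘ = padicValRat p`, `h₀ = logHeight₁`. The quantity `δ(a)` of (1.6) equals
Stewart's `δ = stewartDelta p α` when the Kummer condition (1.7) = Stewart's (16) holds ((1.8)), and
`δ(a) ≥ 1 = stewartDelta p α` otherwise (`(p−1)/δ(a)` is the order of a subgroup of `𝔽ₚˣ`); since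
`C₁` is non-increasing in `δ`, Theorem I implies its own instance with `δ(a)` replaced by
`stewartDelta p α`, and THAT instance, verbatim otherwise, is the hypothesis `H` below
(`yuC1Rat` = (1.9), `yuH1Rat` = (1.13) with (1.14), (1.15), (1.11), the side condition (1.17) on the
last index). What this file proves:

* `yuC1Rat_eq` — Yu's (1.9) at `d = 1` is EXACTLY `(1790/1794) · C₁^{Stewart}` (`stewartC1`; the
  identity `nⁿ/(2 log p) · max{p/(δ (log p)^{n+1}), eⁿ/nⁿ} = 1/(2 (log p)²) · max{(p/δ)(n/log p)ⁿ, eⁿ log p}`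
  and `max{log(e⁴(n+1)), 1, log p} = max{log(e⁴(n+1)), log p}`), hence `yuC1Rat ≤ stewartC1`;
* `log_three_le_logHeight₁_or` — of two multiplicatively independent rationals at least one has
  height `≥ log 3` (a rational of height `< log 3` other than `0, ±1` is `±2^{±1}`), so with
  `h₀ ≥ log 2` (`log_two_le_logHeight₁`): `1/h₀(αⱼ) + 1/h₀(αₙ) ≤ 1/log 2 + 1/log 3 = 1/ω(1)`
  (`one_div_logHeight₁_add_le`), and the first term of `h⁽¹⁾` is `≤ log max|bᵢ|`
  (`yuOmegaOne_mul_yuCross_le`) — Stewart's remark "Voutier's explicit Dobrowolski allows us to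
  replace the first term … by log B", which over `ℚ` needs no Dobrowolski bound;
* `yuH1Rat_le` — `h⁽¹⁾ ≤ max(log B_S, G₁(n,1), (n+1) log p)` with Stewart's `B_S = max(2, |bᵢ|)`;
* `stewartDelta_reindex`, `multIndep_reindex` — Stewart's data are invariant under permuting the
  indices, so (1.17) may be assumed after re-indexing ("(1.15) holds since our result is symmetric
  in the `bᵢ`'s" in Stewart's proof; (1.15) of the preprint he cites = (1.17) of the journal);
* `yuDisplay_of_yuTheoremI` — **Theorem I over `ℚ` (hypothesis `H`, printed shape) implies the
  display (P) with Yu's `G₁(n,1)` for all `n ≥ 2`**, i.e. exactly the hypothesis of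
  `Stewart2013_lemma5_rat_of_yuBound`; and hence
* `Stewart2013_lemma5_rat_of_yuTheoremI` — **Theorem I over `ℚ` implies the named fact.**

Nothing of Theorem I itself (p-adic logarithmic forms: §§2–7 of [Yu2013] on top of Yu 2007) is
proved in the tree; for `n ≥ 2`, `B > 10⁸` the named fact is exactly this apex.

## References

* [Yu2013] K. Yu, *p-adic logarithmic forms and a problem of Erdős*, Acta Math. 211 (2013),
  315–382: (1.3)–(1.9) pp. 319–320, (1.11)–(1.15) pp. 320–321, Main Theorem (1.16)–(1.18) p. 321,
  §1.3 (1.28)–(1.31) p. 324, §1.4 Theorems I, II p. 325.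
* [Stewart2013] C. L. Stewart, *On divisors of Lucas and Lehmer numbers*, Acta Math. 211 (2013),
  291–314 (arXiv:1008.1274), §3, proof of Lemma 5 (p. 8) = Lemma 3.1 (pp. 301–302).
-/

open Height Real Finset

noncomputable section

namespace Literature.NumberTheory.DiophantineGeometry.Dioph

/-! ### Yu's printed quantities for `K = ℚ` (`d = 1`, `e_℘ = f_℘ = 1`, `q^u = 2`) -/

/-- **Yu's `C₁(n, d, ℘, a)` at `d = 1`, `p ≥ 5`** ((1.9) with the case (III.2) values
`c⁽¹⁾ = 1790`, `a⁽¹⁾ = 7(p−1)/(p−2)`; `d^{n+2} log* d = 1`, `q^u f_℘ log p = 2 log p`, `e_℘ = 1`),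
as a function of `n`, `p` and the parameter `δ` standing for `δ(a)`:
`C₁ = 1790 (7(p−1)/(p−2))ⁿ · nⁿ(n+1)^{n+1}/n! · 1/(2 log p) · max{p/(δ (log p)^{n+1}), eⁿ/nⁿ}
      · max{log(e⁴(n+1)), 1, log p}`. [cite: Yu2013, (1.9), (1.28), (1.30)] -/
def yuC1Rat (n p : ℕ) (δ : ℝ) : ℝ :=
  1790 * (7 * (((p : ℝ) - 1) / ((p : ℝ) - 2))) ^ n *
    ((n : ℝ) ^ n * ((n : ℝ) + 1) ^ (n + 1) / (n.factorial : ℝ)) *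
    (1 / (2 * Real.log p)) *
    max ((p : ℝ) / (δ * Real.log p ^ (n + 1))) (Real.exp n / (n : ℝ) ^ n) *
    max (Real.log (Real.exp 4 * (n + 1))) (max 1 (Real.log p))

/-- Unfolding lemma for `yuC1Rat`. [cite: Yu2013, (1.9)] -/
theorem yuC1Rat_def (n p : ℕ) (δ : ℝ) : yuC1Rat n p δ =
    1790 * (7 * (((p : ℝ) - 1) / ((p : ℝ) - 2))) ^ n *
      ((n : ℝ) ^ n * ((n : ℝ) + 1) ^ (n + 1) / (n.factorial : ℝ)) *
      (1 / (2 * Real.log p)) *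
      max ((p : ℝ) / (δ * Real.log p ^ (n + 1))) (Real.exp n / (n : ℝ) ^ n) *
      max (Real.log (Real.exp 4 * (n + 1))) (max 1 (Real.log p)) :=
  rfl

/-- **Yu's `ω(1) = log 2 · log 3 / log 6`** ((1.15), case `d = 1`). [cite: Yu2013, (1.15)] -/
def yuOmegaOne : ℝ :=
  Real.log 2 * Real.log 3 / Real.log 6

/-- **Yu's `B = min_{1 ≤ j ≤ n, bⱼ ≠ 0} |bⱼ|`** ((1.14); `0` for `b = 0`, which the theorem
excludes). [cite: Yu2013, (1.14)] -/
def yuB {n : ℕ} (b : Fin n → ℤ) : ℕ :=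
  sInf {m : ℕ | ∃ j, b j ≠ 0 ∧ (b j).natAbs = m}

/-- The index `0` differs from the last index in `Fin (m+2)` (so the index set `1 ≤ j < n` of
(1.13) is non-empty for `n = m + 2 ≥ 2`). [folklore] -/
theorem zero_mem_erase_last (m : ℕ) :
    (0 : Fin (m + 2)) ∈ (univ : Finset (Fin (m + 2))).erase (Fin.last (m + 1)) :=
  Finset.mem_erase.mpr ⟨(Fin.last_pos' : (0 : Fin (m + 2)) < Fin.last (m + 1)).ne, mem_univ _⟩

/-- **The inner maximum of the first term of Yu's `h⁽¹⁾`** ((1.13)) for `n = m + 2` logarithms,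
the distinguished index `n` being the last one:
`max_{1 ≤ j < n} (|bₙ|/h₀(αⱼ) + |bⱼ|/h₀(αₙ))`. [cite: Yu2013, (1.13)] -/
def yuCross {m : ℕ} (α : Fin (m + 2) → ℚ) (b : Fin (m + 2) → ℤ) : ℝ :=
  ((univ : Finset (Fin (m + 2))).erase (Fin.last (m + 1))).sup' ⟨0, zero_mem_erase_last m⟩
    fun j => ((b (Fin.last (m + 1))).natAbs : ℝ) / logHeight₁ (α j) +
      ((b j).natAbs : ℝ) / logHeight₁ (α (Fin.last (m + 1)))

/-- **Yu's `h⁽¹⁾` for `K = ℚ`, `p ≥ 5`** ((1.13) with (1.14), (1.15) and `G₁(n,1) = yuG1Rat n`,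
`f_℘ = 1`), for `n = m + 2` logarithms:
`h⁽¹⁾ = max{ log(ω(1) · max_{j<n}(|bₙ|/h₀(αⱼ) + |bⱼ|/h₀(αₙ))), log B, G₁(n,1), (n+1) log p }`.
[cite: Yu2013, (1.13), (1.14), (1.15), (1.11)] -/
def yuH1Rat {m : ℕ} (p : ℕ) (α : Fin (m + 2) → ℚ) (b : Fin (m + 2) → ℤ) : ℝ :=
  max (Real.log (yuOmegaOne * yuCross α b))
    (max (Real.log (yuB b)) (max (yuG1Rat (m + 2)) ((((m + 2 : ℕ) : ℝ) + 1) * Real.log p)))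

/-! ### `C₁` of (1.9) against Stewart's `C₁` -/

/-- **Yu's (1.9) at `d = 1` is `(1790/1794)` times Stewart's `C₁`** (`stewartC1`, which Stewart
writes with `c⁽¹⁾ = 1794` and in the algebraically rearranged form
`1/(2 (log p)²) · max{(p/δ)(n/log p)ⁿ, eⁿ log p} · max{log(e⁴(n+1)), log p}`), for `n ≥ 1`,
`p ≥ 5`. [cite: Yu2013, (1.9); Stewart2013, proof of Lemma 5 (display before (17))] -/
theorem yuC1Rat_eq {n p : ℕ} (hn : 1 ≤ n) (hp5 : 5 ≤ p) (δ : ℝ) :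
    yuC1Rat n p δ = 1790 / 1794 * stewartC1 n p δ := by
  have hp' : (5 : ℝ) ≤ p := by exact_mod_cast hp5
  rw [yuC1Rat_def, stewartC1_def]
  set L := Real.log p with hL
  set A := Real.log (Real.exp 4 * (n + 1)) with hA
  set M₁ := max ((p : ℝ) / (δ * L ^ (n + 1))) (Real.exp n / (n : ℝ) ^ n) with hM₁
  set M₂ := max ((p : ℝ) / δ * ((n : ℝ) / L) ^ n) (Real.exp n * L) with hM₂
  have hL0 : 0 < L := lt_trans (by norm_num) (log_gt_d4_of_five_le hp5)
  have hN0 : (0 : ℝ) < n := by exact_mod_cast hn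
  have hNn : (0 : ℝ) < (n : ℝ) ^ n := pow_pos hN0 n
  have hfac : (n.factorial : ℝ) ≠ 0 := by positivity
  have hA4 : 4 ≤ A := by
    rw [hA, Real.log_mul (Real.exp_pos 4).ne' (by positivity), Real.log_exp]
    have : (0 : ℝ) ≤ Real.log (n + 1) :=
      Real.log_nonneg (by have : (0 : ℝ) ≤ n := Nat.cast_nonneg n; linarith)
    linarith
  -- the two maxima
  have hmax1 : (n : ℝ) ^ n * L * M₁ = M₂ := by
    rw [hM₁, hM₂, mul_max_of_nonneg _ _ (by positivity : (0 : ℝ) ≤ (n : ℝ) ^ n * L)]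
    congr 1
    · rw [div_pow]
      field_simp
      ring
    · field_simp
  have hmax2 : max A (max 1 L) = max A L := by
    rw [← max_assoc, max_eq_left (by linarith : (1 : ℝ) ≤ A)]
  rw [hmax2, ← hmax1]
  field_simp

/-- Stewart's `C₁ ≥ 0` (for `p ≥ 5` and every `δ`: the factor `max{⋯, eⁿ log p}` is `≥ eⁿ log p > 0`).
[cite: Stewart2013, proof of Lemma 5] -/
theorem stewartC1_nonneg (n : ℕ) {p : ℕ} (hp5 : 5 ≤ p) (δ : ℝ) :
    0 ≤ stewartC1 n p δ := by
  have hp' : (5 : ℝ) ≤ p := by exact_mod_cast hp5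
  have hL0 : 0 < Real.log p := Real.log_pos (by linarith)
  have h1 : 0 < (p : ℝ) - 1 := by linarith
  have h2 : 0 < (p : ℝ) - 2 := by linarith
  have hM : 0 ≤ max ((p : ℝ) / δ * ((n : ℝ) / Real.log p) ^ n) (Real.exp n * Real.log p) :=
    le_trans (by positivity) (le_max_right _ _)
  have hA : 0 ≤ max (Real.log (Real.exp 4 * (n + 1))) (Real.log p) :=
    le_trans hL0.le (le_max_right _ _)
  rw [stewartC1_def]
  positivity

/-- **`C₁^{Yu} ≤ C₁^{Stewart}`** (`1790 ≤ 1794`), for `n ≥ 1`, `p ≥ 5` and every `δ`.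
[cite: Yu2013, (1.9), (1.30); Stewart2013, proof of Lemma 5] -/
theorem yuC1Rat_le_stewartC1 {n p : ℕ} (hn : 1 ≤ n) (hp5 : 5 ≤ p) (δ : ℝ) :
    yuC1Rat n p δ ≤ stewartC1 n p δ := by
  rw [yuC1Rat_eq hn hp5 δ]
  have h := stewartC1_nonneg n hp5 δ
  nlinarith

/-! ### Heights of two multiplicatively independent rationals, and the first term of `h⁽¹⁾` -/

/-- A rational number of height `< log 3` other than `0, 1, −1` is `±2` or `±1/2`, so its square is
`4` or `1/4` (`h(a/c) = log max(|a|, c)` in lowest terms). [folklore] -/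
theorem sq_eq_of_logHeight₁_lt_log_three {x : ℚ} (h0 : x ≠ 0) (h1 : x ≠ 1) (hm1 : x ≠ -1)
    (hlt : logHeight₁ x < Real.log 3) : x ^ 2 = 4 ∨ x ^ 2 = 4⁻¹ := by
  rw [Rat.logHeight₁_eq_log_max] at hlt
  have hden : 0 < x.den := x.den_pos
  have hmax0 : (0 : ℝ) < ((max x.num.natAbs x.den : ℕ) : ℝ) := by
    exact_mod_cast lt_of_lt_of_le hden (le_max_right _ _)
  have hlt3 : ((max x.num.natAbs x.den : ℕ) : ℝ) < 3 := by
    rwa [Real.log_lt_log_iff hmax0 (by norm_num)] at hlt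
  have hlt3' : max x.num.natAbs x.den < 3 := by exact_mod_cast hlt3
  have hA : x.num.natAbs ≤ 2 := by have := le_max_left x.num.natAbs x.den; omega
  have hD : x.den ≤ 2 := by have := le_max_right x.num.natAbs x.den; omega
  have hA0 : x.num.natAbs ≠ 0 := Int.natAbs_ne_zero.mpr (Rat.num_ne_zero.mpr h0)
  have hcop : Nat.Coprime x.num.natAbs x.den := x.reduced
  have hsq : x ^ 2 = ((x.num.natAbs : ℚ) ^ 2) / ((x.den : ℚ) ^ 2) := by
    conv_lhs => rw [← Rat.num_div_den x]
    rw [div_pow, Nat.cast_natAbs, Int.cast_abs, sq_abs]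
  obtain hA1 | hA2 : x.num.natAbs = 1 ∨ x.num.natAbs = 2 := by omega
  · obtain hD1 | hD2 : x.den = 1 ∨ x.den = 2 := by omega
    · -- `x = ±1`
      exfalso
      have hx1 : x ^ 2 = 1 := by rw [hsq, hA1, hD1]; norm_num
      rcases sq_eq_one_iff.mp hx1 with h | h
      · exact h1 h
      · exact hm1 h
    · right
      rw [hsq, hA1, hD2]; norm_num
  · obtain hD1 | hD2 : x.den = 1 ∨ x.den = 2 := by omega
    · left
      rw [hsq, hA2, hD1]; norm_num
    · exfalso
      rw [hA2, hD2] at hcop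
      exact absurd hcop (by decide)

/-- **Of two members of a multiplicatively independent family of non-zero rationals, at least one
has height `≥ log 3`** (both are `≠ ±1`; if both had height `< log 3` their squares would lie in
`{4, 1/4}` and `αᵢ² αⱼ^{±2} = 1` would be a non-trivial relation). [folklore] -/
theorem log_three_le_logHeight₁_or {k : ℕ} {α : Fin k → ℚ} (hα0 : ∀ i, α i ≠ 0)
    (hind : ∀ e : Fin k → ℤ, ∏ i, α i ^ e i = 1 → e = 0) {i j : Fin k} (hij : i ≠ j) :
    Real.log 3 ≤ logHeight₁ (α i) ∨ Real.log 3 ≤ logHeight₁ (α j) := by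
  by_contra h
  push Not at h
  obtain ⟨hi1, him1⟩ := ne_one_and_ne_neg_one_of_multIndep hind i
  obtain ⟨hj1, hjm1⟩ := ne_one_and_ne_neg_one_of_multIndep hind j
  have hi := sq_eq_of_logHeight₁_lt_log_three (hα0 i) hi1 him1 h.1
  have hj := sq_eq_of_logHeight₁_lt_log_three (hα0 j) hj1 hjm1 h.2
  -- a relation `αᵢ² αⱼᶜ = 1` with the exponent vector `2δᵢ + cδⱼ` contradicts independence
  have key : ∀ c : ℤ, α i ^ (2 : ℤ) * α j ^ c = 1 → False := by
    intro c hc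
    set e : Fin k → ℤ := Pi.single i 2 + Pi.single j c with he
    have hprod : ∏ l, α l ^ e l = 1 := by
      have hsplit : ∀ l, α l ^ e l =
          α l ^ (Pi.single i (2 : ℤ) : Fin k → ℤ) l * α l ^ (Pi.single j c : Fin k → ℤ) l := by
        intro l
        rw [he, Pi.add_apply, zpow_add₀ (hα0 l)]
      rw [Finset.prod_congr rfl (fun l _ => hsplit l), Finset.prod_mul_distrib,
        Fintype.prod_eq_single i (fun l hl => by rw [Pi.single_eq_of_ne hl, zpow_zero]),
        Fintype.prod_eq_single j (fun l hl => by rw [Pi.single_eq_of_ne hl, zpow_zero]),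
        Pi.single_eq_same, Pi.single_eq_same]
      exact hc
    have h0 := congr_fun (hind e hprod) i
    rw [he, Pi.add_apply, Pi.single_eq_same, Pi.single_eq_of_ne hij, Pi.zero_apply] at h0
    norm_num at h0
  rcases hi with hi | hi <;> rcases hj with hj | hj
  · exact key (-2) (by rw [zpow_neg, zpow_ofNat, zpow_ofNat, hi, hj]; norm_num)
  · exact key 2 (by rw [zpow_ofNat, zpow_ofNat, hi, hj]; norm_num)
  · exact key 2 (by rw [zpow_ofNat, zpow_ofNat, hi, hj]; norm_num)
  · exact key (-2) (by rw [zpow_neg, zpow_ofNat, zpow_ofNat, hi, hj]; norm_num)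

/-- **`1/h₀(αᵢ) + 1/h₀(αⱼ) ≤ 1/log 2 + 1/log 3`** for two members of a multiplicatively independent
family of non-zero rationals (heights `≥ log 2`, and one of them `≥ log 3`). [folklore] -/
theorem one_div_logHeight₁_add_le {k : ℕ} {α : Fin k → ℚ} (hα0 : ∀ i, α i ≠ 0)
    (hind : ∀ e : Fin k → ℤ, ∏ i, α i ^ e i = 1 → e = 0) {i j : Fin k} (hij : i ≠ j) :
    1 / logHeight₁ (α i) + 1 / logHeight₁ (α j) ≤ 1 / Real.log 2 + 1 / Real.log 3 := by
  have h2 : 0 < Real.log 2 := Real.log_pos (by norm_num)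
  have h3 : 0 < Real.log 3 := Real.log_pos (by norm_num)
  have hi2 : Real.log 2 ≤ logHeight₁ (α i) := log_two_le_logHeight₁ (hα0 i)
    (ne_one_and_ne_neg_one_of_multIndep hind i).1 (ne_one_and_ne_neg_one_of_multIndep hind i).2
  have hj2 : Real.log 2 ≤ logHeight₁ (α j) := log_two_le_logHeight₁ (hα0 j)
    (ne_one_and_ne_neg_one_of_multIndep hind j).1 (ne_one_and_ne_neg_one_of_multIndep hind j).2
  rcases log_three_le_logHeight₁_or hα0 hind hij with hi3 | hj3
  · have a : 1 / logHeight₁ (α i) ≤ 1 / Real.log 3 := one_div_le_one_div_of_le h3 hi3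
    have b : 1 / logHeight₁ (α j) ≤ 1 / Real.log 2 := one_div_le_one_div_of_le h2 hj2
    linarith
  · have a : 1 / logHeight₁ (α i) ≤ 1 / Real.log 2 := one_div_le_one_div_of_le h2 hi2
    have b : 1 / logHeight₁ (α j) ≤ 1 / Real.log 3 := one_div_le_one_div_of_le h3 hj3
    linarith

/-- `ω(1) > 0`. [cite: Yu2013, (1.15)] -/
theorem yuOmegaOne_pos : 0 < yuOmegaOne := by
  unfold yuOmegaOne
  have h2 : 0 < Real.log 2 := Real.log_pos (by norm_num)
  have h3 : 0 < Real.log 3 := Real.log_pos (by norm_num)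
  have h6 : 0 < Real.log 6 := Real.log_pos (by norm_num)
  positivity

/-- `ω(1) · (1/log 2 + 1/log 3) = 1` (`log 6 = log 2 + log 3`). [cite: Yu2013, (1.15)] -/
theorem yuOmegaOne_mul_inv_add_inv : yuOmegaOne * (1 / Real.log 2 + 1 / Real.log 3) = 1 := by
  unfold yuOmegaOne
  have h2 : 0 < Real.log 2 := Real.log_pos (by norm_num)
  have h3 : 0 < Real.log 3 := Real.log_pos (by norm_num)
  have h6 : Real.log 6 = Real.log 2 + Real.log 3 := by
    rw [show (6 : ℝ) = 2 * 3 by norm_num, Real.log_mul (by norm_num) (by norm_num)]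
  have h60 : 0 < Real.log 2 + Real.log 3 := by linarith
  rw [h6]
  field_simp
  ring

/-- The inner maximum of (1.13) is `≥ 0`. [cite: Yu2013, (1.13)] -/
theorem yuCross_nonneg {m : ℕ} (α : Fin (m + 2) → ℚ) (b : Fin (m + 2) → ℤ) : 0 ≤ yuCross α b := by
  unfold yuCross
  refine le_trans ?_ (Finset.le_sup' _ (zero_mem_erase_last m))
  exact add_nonneg (div_nonneg (Nat.cast_nonneg _) (zero_le_logHeight₁ _))
    (div_nonneg (Nat.cast_nonneg _) (zero_le_logHeight₁ _))

/-- **The first term of `h⁽¹⁾` over `ℚ`: `ω(1) · max_{j<n}(|bₙ|/h₀(αⱼ) + |bⱼ|/h₀(αₙ)) ≤ B`**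
whenever `|bⱼ| ≤ B` for all `j` (`0 ≤ B`), for a multiplicatively independent family of non-zero
rationals: each summand pair is `≤ B (1/h₀(αⱼ) + 1/h₀(αₙ)) ≤ B/ω(1)`. This is the remark of
Stewart's proof ("… allows us to replace the first term in the maximum defining `h⁽¹⁾` by
`log B`"), which over `ℚ` needs no Dobrowolski-type bound. [cite: Yu2013, (1.13)–(1.15);
Stewart2013, proof of Lemma 5] -/
theorem yuOmegaOne_mul_yuCross_le {m : ℕ} {α : Fin (m + 2) → ℚ} {b : Fin (m + 2) → ℤ}
    (hα0 : ∀ i, α i ≠ 0) (hind : ∀ e : Fin (m + 2) → ℤ, ∏ i, α i ^ e i = 1 → e = 0)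
    {B : ℝ} (hB0 : 0 ≤ B) (hbB : ∀ j, ((b j).natAbs : ℝ) ≤ B) :
    yuOmegaOne * yuCross α b ≤ B := by
  have hω := yuOmegaOne_pos
  have hpos : ∀ i, 0 < logHeight₁ (α i) := fun i =>
    lt_of_lt_of_le (Real.log_pos (by norm_num)) (log_two_le_logHeight₁ (hα0 i)
      (ne_one_and_ne_neg_one_of_multIndep hind i).1 (ne_one_and_ne_neg_one_of_multIndep hind i).2)
  have hsup : yuCross α b ≤ B * (1 / Real.log 2 + 1 / Real.log 3) := by
    unfold yuCross
    refine Finset.sup'_le _ _ fun j hj => ?_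
    have hjne : j ≠ Fin.last (m + 1) := (Finset.mem_erase.mp hj).1
    calc ((b (Fin.last (m + 1))).natAbs : ℝ) / logHeight₁ (α j) +
          ((b j).natAbs : ℝ) / logHeight₁ (α (Fin.last (m + 1)))
        ≤ B / logHeight₁ (α j) + B / logHeight₁ (α (Fin.last (m + 1))) :=
          add_le_add (div_le_div_of_nonneg_right (hbB _) (hpos j).le)
            (div_le_div_of_nonneg_right (hbB _) (hpos _).le)
      _ = B * (1 / logHeight₁ (α j) + 1 / logHeight₁ (α (Fin.last (m + 1)))) := by ring
      _ ≤ B * (1 / Real.log 2 + 1 / Real.log 3) :=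
          mul_le_mul_of_nonneg_left (one_div_logHeight₁_add_le hα0 hind hjne) hB0
  calc yuOmegaOne * yuCross α b ≤ yuOmegaOne * (B * (1 / Real.log 2 + 1 / Real.log 3)) :=
        mul_le_mul_of_nonneg_left hsup hω.le
    _ = B * (yuOmegaOne * (1 / Real.log 2 + 1 / Real.log 3)) := by ring
    _ = B := by rw [yuOmegaOne_mul_inv_add_inv, mul_one]

/-! ### Yu's `B` against Stewart's `B` -/

/-- `B_Yu ≤ |bⱼ|` for every `bⱼ ≠ 0`. [cite: Yu2013, (1.14)] -/
theorem yuB_le_natAbs {n : ℕ} {b : Fin n → ℤ} {j : Fin n} (hj : b j ≠ 0) :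
    yuB b ≤ (b j).natAbs :=
  Nat.sInf_le ⟨j, hj, rfl⟩

/-- For `b ≠ 0`, `B_Yu = |bⱼ|` for some `bⱼ ≠ 0`. [cite: Yu2013, (1.14)] -/
theorem exists_natAbs_eq_yuB {n : ℕ} {b : Fin n → ℤ} (hb : b ≠ 0) :
    ∃ j, b j ≠ 0 ∧ (b j).natAbs = yuB b := by
  obtain ⟨j, hj⟩ := Function.ne_iff.mp hb
  have hne : {m : ℕ | ∃ j, b j ≠ 0 ∧ (b j).natAbs = m}.Nonempty := ⟨_, j, hj, rfl⟩
  exact Nat.sInf_mem hne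

/-- **`h⁽¹⁾ ≤ max(log B_S, G₁(n,1), (n+1) log p)` over `ℚ`** for any natural number `B_S ≥ 2`
dominating all `|bⱼ|` (Stewart's `B = max(2, |bᵢ|)`), `b ≠ 0`, `α` a multiplicatively
independent family of non-zero rationals: the first term of (1.13) is `≤ log B_S`
(`yuOmegaOne_mul_yuCross_le`) and `log B_Yu ≤ log B_S` (`B_Yu = min_{bⱼ≠0} |bⱼ| ≥ 1`).
[cite: Yu2013, (1.13)–(1.15); Stewart2013, proof of Lemma 5] -/
theorem yuH1Rat_le {m : ℕ} (p : ℕ) {α : Fin (m + 2) → ℚ} {b : Fin (m + 2) → ℤ}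
    (hα0 : ∀ i, α i ≠ 0) (hind : ∀ e : Fin (m + 2) → ℤ, ∏ i, α i ^ e i = 1 → e = 0)
    (hb : b ≠ 0) {B : ℕ} (h2B : 2 ≤ B) (hbB : ∀ j, (b j).natAbs ≤ B) :
    yuH1Rat p α b ≤
      max (Real.log B) (max (yuG1Rat (m + 2)) ((((m + 2 : ℕ) : ℝ) + 1) * Real.log p)) := by
  have hB1 : (1 : ℝ) < B := by exact_mod_cast lt_of_lt_of_le one_lt_two h2B
  have hlogB : 0 ≤ Real.log B := Real.log_nonneg hB1.le
  -- the first term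
  have h1 : Real.log (yuOmegaOne * yuCross α b) ≤ Real.log B := by
    have hle : yuOmegaOne * yuCross α b ≤ B :=
      yuOmegaOne_mul_yuCross_le hα0 hind (by positivity) (fun j => by exact_mod_cast hbB j)
    rcases (mul_nonneg yuOmegaOne_pos.le (yuCross_nonneg α b)).eq_or_lt with h0 | hpos
    · rw [← h0, Real.log_zero]; exact hlogB
    · exact Real.log_le_log hpos hle
  -- the second term
  have h2 : Real.log (yuB b : ℝ) ≤ Real.log B := by
    obtain ⟨j, hj, hjB⟩ := exists_natAbs_eq_yuB hb
    have h1le : 1 ≤ yuB b := by rw [← hjB]; exact Int.natAbs_pos.mpr hj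
    have hle : yuB b ≤ B := hjB ▸ hbB j
    exact Real.log_le_log (by exact_mod_cast h1le) (by exact_mod_cast hle)
  unfold yuH1Rat
  exact max_le (le_max_of_le_left h1) (max_le (le_max_of_le_left h2) (le_max_right _ _))

/-! ### Re-indexing: Stewart's data are symmetric in the indices -/

/-- Multiplicative independence is invariant under re-indexing. [folklore] -/
theorem multIndep_reindex {n : ℕ} {α : Fin n → ℚ} (σ : Fin n ≃ Fin n)
    (hind : ∀ e : Fin n → ℤ, ∏ i, α i ^ e i = 1 → e = 0) :
    ∀ e : Fin n → ℤ, ∏ i, (α ∘ σ) i ^ e i = 1 → e = 0 := by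
  intro e he
  have h1 : ∏ i, α i ^ (e ∘ σ.symm) i = 1 := by
    rw [← Equiv.prod_comp σ (fun i => α i ^ (e ∘ σ.symm) i)]
    simpa using he
  have h2 := hind _ h1
  funext j
  have := congr_fun h2 (σ j)
  simpa using this

/-- The Kummer condition (16) is invariant under re-indexing (the adjoined set is the same).
[cite: Stewart2013, (16)] -/
theorem stewartKummerCondition_reindex {n : ℕ} (σ : Fin n ≃ Fin n) (α : Fin n → ℚ) :
    StewartKummerCondition (α ∘ σ) ↔ StewartKummerCondition α := by
  unfold StewartKummerCondition
  have : (Set.range fun i : Fin n => (((α ∘ σ) i : ℚ) : ℂ) ^ (1 / 2 : ℂ)) =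
      Set.range fun i : Fin n => ((α i : ℚ) : ℂ) ^ (1 / 2 : ℂ) :=
    σ.surjective.range_comp (fun i : Fin n => ((α i : ℚ) : ℂ) ^ (1 / 2 : ℂ))
  rw [this]

/-- `|⟨−1, ᾱ₁, …, ᾱₙ⟩|` is invariant under re-indexing. [cite: Stewart2013, §3 (definition of δ)] -/
theorem stewartSubgroupCard_reindex (p : ℕ) {n : ℕ} (σ : Fin n ≃ Fin n) (α : Fin n → ℚ) :
    stewartSubgroupCard p (α ∘ σ) = stewartSubgroupCard p α := by
  unfold stewartSubgroupCard
  have : (Set.range fun i : Fin n => ratModP p ((α ∘ σ) i)) =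
      Set.range fun i : Fin n => ratModP p (α i) :=
    σ.surjective.range_comp (fun i : Fin n => ratModP p (α i))
  rw [this]

/-- **Stewart's `δ` is invariant under re-indexing.** [cite: Stewart2013, §3 (definition of δ)] -/
theorem stewartDelta_reindex (p : ℕ) {n : ℕ} (σ : Fin n ≃ Fin n) (α : Fin n → ℚ) :
    stewartDelta p (α ∘ σ) = stewartDelta p α := by
  unfold stewartDelta
  rw [stewartSubgroupCard_reindex p σ α]
  by_cases h : StewartKummerCondition α
  · rw [if_pos h, if_pos ((stewartKummerCondition_reindex σ α).mpr h)]
  · rw [if_neg h, if_neg (mt (stewartKummerCondition_reindex σ α).mp h)]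

/-! ### Theorem I over `ℚ` ⇒ the display (P) ⇒ the named fact -/

/-- **Yu's Theorem I over `ℚ` (printed shape) implies the display (P) with Yu's `G₁(n,1)` for all
`n ≥ 2` (proved).** Hypothesis `H` is [Yu2013, §1.4 Theorem I] for `K = ℚ`, `p ≥ 5`, written for
`n = m + 2` logarithms with the distinguished index `n` = `Fin.last (m+1)`: for multiplicatively
independent `p`-adic units `α₁, …, αₙ ∈ ℚˣ` ((1.16)) and `b ∈ ℤⁿ`, not all zero, with
`ord_p bₙ ≤ ord_p bⱼ` for all `j` ((1.17); as `ord_p 0 = ∞` this reads `bₙ ≠ 0` and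
`v_p(bₙ) ≤ v_p(bⱼ)` whenever `bⱼ ≠ 0`),
`ord_p(α₁^{b₁}⋯αₙ^{bₙ} − 1) < C₁ · h₀(α₁)⋯h₀(αₙ) · h⁽¹⁾` with `C₁ = yuC1Rat n p δ` ((1.9) at
`d = 1`, case (III.2)) and `h⁽¹⁾ = yuH1Rat p α b` ((1.13)–(1.15), (1.11)); here `δ(a)` of (1.6) is
rendered by Stewart's `δ = stewartDelta p α`, which equals `δ(a)` under the Kummer condition (1.7)
by (1.8) and is `1 ≤ δ(a)` otherwise, so that `H` is implied by Theorem I as printed (`C₁` is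
non-increasing in `δ`). NOT proved here: `H`. Conclusion: the display (P) of Stewart's proof over
`ℚ` with Yu's `G₁(n,1)`, verbatim the hypothesis of `Stewart2013_lemma5_rat_of_yuBound`. Proof:
re-index so that a `bⱼ ≠ 0` of least `p`-adic order comes last (`stewartDelta_reindex`,
`multIndep_reindex`; the product, the heights and `B` are symmetric), apply `H`, and use
`yuC1Rat_le_stewartC1` (`1790 ≤ 1794`) and `yuH1Rat_le` (first term `≤ log B`, `B_Yu ≤ B`).
[cite: Yu2013, Theorem I (§1.4) with (1.9), (1.11), (1.13)–(1.17), §1.3 case (III.2);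
Stewart2013, proof of Lemma 5] -/
theorem yuDisplay_of_yuTheoremI
    (H : ∀ (m p : ℕ) (α : Fin (m + 2) → ℚ) (b : Fin (m + 2) → ℤ), p.Prime → 5 ≤ p →
      (∀ i, α i ≠ 0 ∧ padicValRat p (α i) = 0) →
      (∀ e : Fin (m + 2) → ℤ, ∏ i, α i ^ e i = 1 → e = 0) → b ≠ 0 →
      (b (Fin.last (m + 1)) ≠ 0 ∧ ∀ j, b j ≠ 0 →
        padicValInt p (b (Fin.last (m + 1))) ≤ padicValInt p (b j)) →
      (padicValRat p (∏ i, α i ^ b i - 1) : ℝ) <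
        yuC1Rat (m + 2) p (stewartDelta p α) * (∏ i, logHeight₁ (α i)) * yuH1Rat p α b)
    (n p : ℕ) (α : Fin n → ℚ) (b : Fin n → ℤ) (hn : 2 ≤ n) (hp : p.Prime) (hp5 : 5 ≤ p)
    (hα : ∀ i, α i ≠ 0 ∧ padicValRat p (α i) = 0)
    (hind : ∀ e : Fin n → ℤ, ∏ i, α i ^ e i = 1 → e = 0) (hb : b ≠ 0) :
    (padicValRat p (∏ i, α i ^ b i - 1) : ℝ) <
      stewartC1 n p (stewartDelta p α) * (∏ i, logHeight₁ (α i)) *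
        max (Real.log (stewartB b)) (max (yuG1Rat n) ((n + 1) * Real.log p)) := by
  obtain ⟨m, rfl⟩ : ∃ m, n = m + 2 := ⟨n - 2, by omega⟩
  -- a non-zero `bⱼ` of least `p`-adic order
  obtain ⟨j₀, hj₀⟩ := Function.ne_iff.mp hb
  have hS : (univ.filter fun j => b j ≠ 0).Nonempty := ⟨j₀, Finset.mem_filter.mpr ⟨mem_univ _, hj₀⟩⟩
  obtain ⟨i₀, hi₀, hmin⟩ := Finset.exists_min_image _ (fun j => padicValInt p (b j)) hS
  have hbi₀ : b i₀ ≠ 0 := (Finset.mem_filter.mp hi₀).2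
  -- re-index: swap `i₀` and the last index
  set σ : Fin (m + 2) ≃ Fin (m + 2) := Equiv.swap i₀ (Fin.last (m + 1)) with hσ
  have hσlast : σ (Fin.last (m + 1)) = i₀ := by rw [hσ, Equiv.swap_apply_right]
  have hα' : ∀ i, (α ∘ σ) i ≠ 0 ∧ padicValRat p ((α ∘ σ) i) = 0 := fun i => hα (σ i)
  have hind' := multIndep_reindex σ hind
  have hblast : (b ∘ σ) (Fin.last (m + 1)) ≠ 0 := by
    simpa [Function.comp, hσlast] using hbi₀
  have hb' : b ∘ σ ≠ 0 := fun h => hblast (by rw [h]; rfl)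
  have h117 : (b ∘ σ) (Fin.last (m + 1)) ≠ 0 ∧ ∀ j, (b ∘ σ) j ≠ 0 →
      padicValInt p ((b ∘ σ) (Fin.last (m + 1))) ≤ padicValInt p ((b ∘ σ) j) := by
    refine ⟨hblast, fun j hj => ?_⟩
    have hjS : σ j ∈ univ.filter (fun j => b j ≠ 0) := Finset.mem_filter.mpr ⟨mem_univ _, hj⟩
    have := hmin (σ j) hjS
    simpa [Function.comp, hσlast] using this
  have hH := H m p (α ∘ σ) (b ∘ σ) hp hp5 hα' hind' hb' h117
  -- the symmetric quantities
  have hprod : ∏ i, (α ∘ σ) i ^ (b ∘ σ) i = ∏ i, α i ^ b i :=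
    Equiv.prod_comp σ (fun i => α i ^ b i)
  have hheights : ∏ i, logHeight₁ ((α ∘ σ) i) = ∏ i, logHeight₁ (α i) :=
    Equiv.prod_comp σ (fun i => logHeight₁ (α i))
  rw [hprod, hheights, stewartDelta_reindex p σ α] at hH
  -- the two comparisons
  have hC : yuC1Rat (m + 2) p (stewartDelta p α) ≤ stewartC1 (m + 2) p (stewartDelta p α) :=
    yuC1Rat_le_stewartC1 (by omega) hp5 _
  have hM : yuH1Rat p (α ∘ σ) (b ∘ σ) ≤
      max (Real.log (stewartB b)) (max (yuG1Rat (m + 2)) ((((m + 2 : ℕ) : ℝ) + 1) * Real.log p)) :=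
    yuH1Rat_le p (fun i => (hα' i).1) hind' hb' (two_le_stewartB b)
      (fun j => natAbs_le_stewartB b (σ j))
  have hP0 : 0 ≤ ∏ i, logHeight₁ (α i) := Finset.prod_nonneg fun i _ => zero_le_logHeight₁ _
  have hM0 : 0 ≤ yuH1Rat p (α ∘ σ) (b ∘ σ) :=
    le_trans (yuG1Rat_pos _).le
      (le_trans (le_max_left _ _) (le_trans (le_max_right _ _) (le_max_right _ _)))
  have hC0 : 0 ≤ stewartC1 (m + 2) p (stewartDelta p α) := stewartC1_nonneg _ hp5 _
  calc (padicValRat p (∏ i, α i ^ b i - 1) : ℝ)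
      < yuC1Rat (m + 2) p (stewartDelta p α) * (∏ i, logHeight₁ (α i)) *
          yuH1Rat p (α ∘ σ) (b ∘ σ) := hH
    _ ≤ stewartC1 (m + 2) p (stewartDelta p α) * (∏ i, logHeight₁ (α i)) *
          yuH1Rat p (α ∘ σ) (b ∘ σ) :=
        mul_le_mul_of_nonneg_right (mul_le_mul_of_nonneg_right hC hP0) hM0
    _ ≤ stewartC1 (m + 2) p (stewartDelta p α) * (∏ i, logHeight₁ (α i)) *
          max (Real.log (stewartB b)) (max (yuG1Rat (m + 2)) ((((m + 2 : ℕ) : ℝ) + 1) * Real.log p)) :=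
        mul_le_mul_of_nonneg_left hM (mul_nonneg hC0 hP0)

/-- **Yu's Theorem I over `ℚ`, in its printed shape, implies the named fact
`Stewart2013_lemma5_rat` (proved glue).** Hypothesis `H` as in `yuDisplay_of_yuTheoremI`
([Yu2013, Theorem I] for `K = ℚ`, `p ≥ 5`: `C₁` = (1.9) with `c⁽¹⁾ = 1790`,
`a⁽¹⁾ = 7(p−1)/(p−2)`; `h⁽¹⁾` = (1.13) with `ω(1) = log 2 log 3/log 6`, `B = min_{bⱼ≠0}|bⱼ|`,
`G₁(n,1)` with `a₀⁽¹⁾ = 2 + log 7`, `a₁⁽¹⁾ = a₂⁽¹⁾ = 5.84`; side condition (1.17); `δ(a)` rendered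
by Stewart's `δ`, `= δ(a)` under (1.7) by (1.8) and `≤ δ(a)` otherwise). The fact follows by
`yuDisplay_of_yuTheoremI` and Stewart's steps (17)–(18) (`Stewart2013_lemma5_rat_of_yuBound`).
NOT proved in the tree: `H` itself — for `n ≥ 2` and `B > 10⁸` the named fact is exactly Yu's
Theorem I over `ℚ` (p-adic theory of logarithmic forms). [cite: Yu2013, Theorem I (§1.4), Main
Theorem (1.16)–(1.18), (1.9), (1.11), (1.13)–(1.15), §1.3 case (III.2); Stewart2013, Lemma 5 =
Lemma 3.1 and its proof, (16)–(18)] -/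
theorem Stewart2013_lemma5_rat_of_yuTheoremI
    (H : ∀ (m p : ℕ) (α : Fin (m + 2) → ℚ) (b : Fin (m + 2) → ℤ), p.Prime → 5 ≤ p →
      (∀ i, α i ≠ 0 ∧ padicValRat p (α i) = 0) →
      (∀ e : Fin (m + 2) → ℤ, ∏ i, α i ^ e i = 1 → e = 0) → b ≠ 0 →
      (b (Fin.last (m + 1)) ≠ 0 ∧ ∀ j, b j ≠ 0 →
        padicValInt p (b (Fin.last (m + 1))) ≤ padicValInt p (b j)) →
      (padicValRat p (∏ i, α i ^ b i - 1) : ℝ) <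
        yuC1Rat (m + 2) p (stewartDelta p α) * (∏ i, logHeight₁ (α i)) * yuH1Rat p α b) :
    Stewart2013_lemma5_rat :=
  Stewart2013_lemma5_rat_of_yuBound (yuDisplay_of_yuTheoremI H)

/-! ### The same with `δ(a)` abstracted to its two printed properties -/

/-- `C₁^{Yu}` is non-increasing in `δ > 0` (`δ` enters only through `p/(δ (log p)^{n+1})`).
[cite: Yu2013, (1.9)] -/
theorem yuC1Rat_anti {n p : ℕ} (hp5 : 5 ≤ p) {δ δ' : ℝ} (hδ : 0 < δ) (hδδ' : δ ≤ δ') :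
    yuC1Rat n p δ' ≤ yuC1Rat n p δ := by
  have hp' : (5 : ℝ) ≤ p := by exact_mod_cast hp5
  have hL0 : 0 < Real.log p := Real.log_pos (by linarith)
  have h1 : 0 < (p : ℝ) - 1 := by linarith
  have h2 : 0 < (p : ℝ) - 2 := by linarith
  have hA : 0 ≤ max (Real.log (Real.exp 4 * (n + 1))) (max 1 (Real.log p)) :=
    le_trans zero_le_one (le_trans (le_max_left _ _) (le_max_right _ _))
  have hpre : 0 ≤ 1790 * (7 * (((p : ℝ) - 1) / ((p : ℝ) - 2))) ^ n *
      ((n : ℝ) ^ n * ((n : ℝ) + 1) ^ (n + 1) / (n.factorial : ℝ)) * (1 / (2 * Real.log p)) := by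
    positivity
  rw [yuC1Rat_def, yuC1Rat_def]
  apply mul_le_mul_of_nonneg_right _ hA
  apply mul_le_mul_of_nonneg_left _ hpre
  apply max_le_max _ le_rfl
  apply div_le_div_of_nonneg_left (by positivity) (by positivity)
  exact mul_le_mul_of_nonneg_right hδδ' (by positivity)

/-- **The two printed properties of `δ(a)` pin Stewart's `δ` below it**: if `δₐ ≥ 1` and, under
the Kummer condition (16) = (1.7), `(p − 1)/δₐ = |⟨−1, ᾱ₁, …, ᾱₙ⟩|` ((1.8)), then
`stewartDelta p α ≤ δₐ` (with equality in the Kummer case). [cite: Yu2013, (1.6)–(1.8);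
Stewart2013, §3 (definition of δ)] -/
theorem stewartDelta_le_of_yuDelta {p : ℕ} (hp : p.Prime) {n : ℕ} {α : Fin n → ℚ} {δa : ℝ}
    (h1 : 1 ≤ δa)
    (h8 : StewartKummerCondition α → ((p : ℝ) - 1) / δa = stewartSubgroupCard p α) :
    stewartDelta p α ≤ δa := by
  haveI := Fact.mk hp
  unfold stewartDelta
  split_ifs with hK
  · have hN : (0 : ℝ) < stewartSubgroupCard p α := by
      exact_mod_cast one_le_stewartSubgroupCard p α
    have hδa : 0 < δa := lt_of_lt_of_le one_pos h1
    have h := h8 hK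
    rw [div_eq_iff hδa.ne'] at h
    rw [div_le_iff₀ hN, h, mul_comm]
  · exact h1

/-- **Yu's Theorem I over `ℚ` with `δ(a)` entering only through its printed properties implies
the named fact (proved glue; the most faithful form in this file).** Hypothesis `H` is
[Yu2013, §1.4 Theorem I] for `K = ℚ`, `p ≥ 5`, exactly as in `yuDisplay_of_yuTheoremI`, except
that the constant is `C₁ = yuC1Rat n p δₐ` for SOME real `δₐ` having the two properties the paper
prints for `δ(a)`: `δₐ ≥ 1` ((1.6): `(p^{f_℘} − 1)/δ(a)` is the order of a subgroup of the unit
group of the residue field) and, under the Kummer condition (1.7) = (16),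
`(p − 1)/δₐ = |⟨ᾱ₀, ᾱ₁, …, ᾱₙ⟩|` ((1.8)). Theorem I as printed gives `H` with `δₐ = δ(a)`; no
identification of `δ(a)` with Stewart's `δ` is presupposed — it is DERIVED
(`stewartDelta_le_of_yuDelta`, `yuC1Rat_anti`), after which `Stewart2013_lemma5_rat_of_yuTheoremI`
applies. NOT proved in the tree: `H` (p-adic theory of logarithmic forms).
[cite: Yu2013, Theorem I (§1.4), (1.6)–(1.9), (1.11), (1.13)–(1.17), §1.3 case (III.2);
Stewart2013, Lemma 5 = Lemma 3.1 and its proof] -/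
theorem Stewart2013_lemma5_rat_of_yuTheoremI_delta
    (H : ∀ (m p : ℕ) (α : Fin (m + 2) → ℚ) (b : Fin (m + 2) → ℤ), p.Prime → 5 ≤ p →
      (∀ i, α i ≠ 0 ∧ padicValRat p (α i) = 0) →
      (∀ e : Fin (m + 2) → ℤ, ∏ i, α i ^ e i = 1 → e = 0) → b ≠ 0 →
      (b (Fin.last (m + 1)) ≠ 0 ∧ ∀ j, b j ≠ 0 →
        padicValInt p (b (Fin.last (m + 1))) ≤ padicValInt p (b j)) →
      ∃ δa : ℝ, 1 ≤ δa ∧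
        (StewartKummerCondition α → ((p : ℝ) - 1) / δa = stewartSubgroupCard p α) ∧
        (padicValRat p (∏ i, α i ^ b i - 1) : ℝ) <
          yuC1Rat (m + 2) p δa * (∏ i, logHeight₁ (α i)) * yuH1Rat p α b) :
    Stewart2013_lemma5_rat := by
  refine Stewart2013_lemma5_rat_of_yuTheoremI fun m p α b hp hp5 hα hind hb h117 => ?_
  obtain ⟨δa, h1, h8, hlt⟩ := H m p α b hp hp5 hα hind hb h117
  have hδ : 0 < stewartDelta p α := lt_of_lt_of_le one_pos (one_le_stewartDelta hp hα)
  have hC : yuC1Rat (m + 2) p δa ≤ yuC1Rat (m + 2) p (stewartDelta p α) :=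
    yuC1Rat_anti hp5 hδ (stewartDelta_le_of_yuDelta hp h1 h8)
  have hP0 : 0 ≤ ∏ i, logHeight₁ (α i) := Finset.prod_nonneg fun i _ => zero_le_logHeight₁ _
  have hM0 : 0 ≤ yuH1Rat p α b :=
    le_trans (yuG1Rat_pos _).le
      (le_trans (le_max_left _ _) (le_trans (le_max_right _ _) (le_max_right _ _)))
  exact lt_of_lt_of_le hlt (mul_le_mul_of_nonneg_right (mul_le_mul_of_nonneg_right hC hP0) hM0)

end Literature.NumberTheory.DiophantineGeometry.Dioph
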